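import Summits.QuantumFields.BalabanUV.Beta.GAN24.CombTransportPush
import Summits.QuantumFields.BalabanUV.Beta.GAN24.CombCubicStepTransport
import Summits.QuantumFields.BalabanUV.Beta.GAN24.SrecWilsonSector
import Summits.QuantumFields.BalabanUV.Beta.FP.NestedDressingKernel

/-!
# The (III′) cubic-Wilson step, in the adopted units, is ONE three-leg push through the CONJUGATED dressed legs `ψ♭ ∘ R_j`

NOT IN PRINT — OUR BOOKKEEPING (road-P2 = `b2b-balaban-gan24-p2` gen 55, 2026-08-25; row G-an2-4 ∕ (CONV-C), the (α-0) chain at row D1's literal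
OF RECORD (III′) `JsB12CombShSym`; [folklore] composition BY NAME; 0 `def`, 0 cite, 0 `sorry`).  Weight 0.  NEVER «G-an2-4 closed» as (CONV-C);
NOT D1, NOT BetaPertH, NOT continuum, NOT Clay; NO campaign opened (an2 W-4).

## What is proved (generic `d`)
Write `Ψ̂ = psiKS r n`, `𝒯 X κ u = Ψ̂ᵀ ∘ slotPsiS r n X κ u ∘ Ψ̂` (M.43 `CombCubicStepTransport`), `ψ♭ α x κ u = Ψ̂ u x (inl κ) (inl α)` (M.47 `CombTransportPush`),
`R_j = respStepBmSeq ρ_c Lc j` (`ρ_c = ctr (d+1) Lc`), `c₃ = cE·Lc^{2(d+1)}`.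
* §1 **UNITS COMMUTE WITH THE FIXED TRANSPORT** (any `sf sm`, any table): `counitK_conj_psiKS` (`D⁻¹(Ψ̂ᵀVΨ̂)D⁻¹ = Ψ̂ᵀ(D⁻¹VD⁻¹)Ψ̂` — `Ψ̂`'s mixed blocks vanish
  and the leg weights are constant on each fibre type; `FP.NestedDressingKernel.comp_scaleK_of_comm ∕ scaleK_comp_of_comm` BY NAME), `slotPsiS_unitS` (via a
  PRIVATE generic bridge `slotPsiS_map` — public home: leaf-03's `PsiTableDefectOfDivergences`), `unitS_transport : unitS sf sm (𝒯 X) = 𝒯 (unitS sf sm X)`.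
* §2 **ONE (III′) CUBIC STEP IN UNITS** (no tower object; any localised table `X`): `unitS_{j+1} ((cE·wE (j+1)) • e3OfK Lc (GcombSh Lc j) X)
  = c₃ • e3K (coDressKBmAt ρ_c Lc K̃_j) Lc (unitS_j (𝒯 X))` (`unitS_combCubicStep_eq`: M.43 `e3OfK_GcombSh_eq_bm_transport` + the OWNER's
  `SrecUnits.unitS_cubicPiece_eq` + asym1's `unitK_coDressKBmAt`, exactly leaf-03's `SrecWilsonSector.unitS_wilsonSecAt_succ` with `𝒯 X` in the table
  slot); for ff-valued `X`: `= c₃ • push₃ R_j R_j R_j (unitS_j (𝒯 X))` (`_eq_push₃`, leaf-03's `e3K_coDressKBmAt_KStepUnit_of_isFF`) and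
  `= c₃ • push₃ (ψ♭∘R_j) (ψ♭∘R_j) (ψ♭∘R_j) (unitS_j X)` (`_eq_push₃_legComp`: §1 + M.47 `push₃_transport_eq_push₃_legComp`).
* §3 **ANY FAMILY OBEYING THE (III′) WILSON RECURSION** `W 0 = cE • wilsonA`, `W (j+1) = (cE·wE (j+1)) • e3OfK Lc (GcombSh Lc j) (W j)` (hypotheses — the
  (III′) Wilson lineage is NOT defined here; leaf-03's `wilsonSecAt` is its (E) twin) is ff-valued and localised at every level, and IN UNITS member `k+1`
  is `(cE·c₃^{k+1}) • push₃ T′ T′ T′ (wilsonA d)`, `T′ = legChain (fun j ↦ ψ♭ ∘ R_j) 0 k` (`unitS_combWilson_succ_eq_push₃`; leaf-01's `Push3Nest.transport_push₃`;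
  the conjugated legs are localised: `legDecay_legComp_psiKS`).  At (E) the same statement with `T = legChain R 0 k` is leaf-03's
  `unitS_wilsonSecAt_succ_eq_push₃`: **the (III′) Wilson sector differs from the (E) one EXACTLY by `R_j ↦ ψ♭ ∘ R_j` in every leg.**
-/

open Finset
open scoped BigOperators
open Literature.MathematicalPhysics.QuantumFieldTheory
open Literature.MathematicalPhysics.QuantumFieldTheory.Balaban1983to89
open Literature.MathematicalPhysics.QuantumFieldTheory.Balaban1983to89.Beta
open ExpKernelCalculus (MKer Decays comp)
open AffineAveraging (Site box toSite)
open AveragingContoursRooted (ctr ctrOff ctrOff_mem_box)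
open OneStepResolventKernel (Fib LocStencil)
open OneStepKernelFamily (KInvStep)
open BalabanStepJetsSucc (wE)
open StepJetData (wilsonA locStencil_wilsonA locStencil_smul)
open HessKerRate (scaleK)
open Summit.QuantumFields.BalabanUV.Beta.TameKernelCalculus (trK trK_apply)
open Summit.QuantumFields.BalabanUV.Beta.HessKerDressedUnits (unitK unitS unitS_apply counitK counitK_apply legScale legScale_inl legScale_inr locStencil_unitS)
open Summit.QuantumFields.BalabanUV.Beta.GAN24.CombesThomas (sfStep smStep sfStep_ne_zero smStep_ne_zero KStepUnit)
open Summit.QuantumFields.BalabanUV.Beta.GAN24.ThirdJetKernel (e3K)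
open Summit.QuantumFields.BalabanUV.Beta.AxialDressingRooted (coDressKBmAt one_le_of_neZero)
open Summit.QuantumFields.BalabanUV.Beta.HessKerCoDressedBmWall (unitK_coDressKBmAt)
open Summit.QuantumFields.BalabanUV.Beta.SpineRooted (e3OfK e3OfK_apply locStencil_e3OfK)
open Summit.QuantumFields.BalabanUV.Beta.GAN24.CubicReadoutDecLift (e3OfK_eq_e3K)
open Summit.QuantumFields.BalabanUV.Beta.GAN24.SrecUnits (unitS_cubicPiece_eq KStepUnit_eq)
open Summit.QuantumFields.BalabanUV.Beta.GAN24.StencilSlotOfShapes (unitS_step_zero)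
open Summit.QuantumFields.BalabanUV.Beta.GAN24.Push4 (legComp IsFF isFF_mmRead)
open Summit.QuantumFields.BalabanUV.Beta.GAN24.Push4Bounds (LegDecay)
open Summit.QuantumFields.BalabanUV.Beta.GAN24.Push4Iter (LegFam legChain)
open Summit.QuantumFields.BalabanUV.Beta.GAN24.Push4NestAux (legDecay_legComp)
open Summit.QuantumFields.BalabanUV.Beta.GAN24.Push3 (push₃ push₃_smul)
open Summit.QuantumFields.BalabanUV.Beta.GAN24.AffineUnroll (transport transport_zero transport_succ)
open Summit.QuantumFields.BalabanUV.Beta.GAN24.Push3Nest (transport_push₃)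
open Summit.QuantumFields.BalabanUV.Beta.GAN24.RespStepBmDecompExact (respStepBmSeq)
open Summit.QuantumFields.BalabanUV.Beta.GAN24.SrecWilsonSector (isFF_unitS isFF_smul isFF_wilsonA e3K_coDressKBmAt_KStepUnit_of_isFF legDecay_respStepBmSeq)
open Summit.QuantumFields.BalabanUV.Beta.SymCorrectorKernel (psiKS psiKS_inl_inr psiKS_inr_inl)
open Summit.QuantumFields.BalabanUV.Beta.SymCorrectorFace (slotPsiS slotPsiS_apply_kernel)
open Summit.QuantumFields.BalabanUV.Beta.CombChartStepJets (GcombSh decays_GcombSh)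
open Summit.QuantumFields.BalabanUV.Beta.FP.NestedDressingKernel (comp_scaleK_of_comm scaleK_comp_of_comm)
open Summit.QuantumFields.BalabanUV.Beta.GAN24.CombCubicStepTransport (e3OfK_GcombSh_eq_bm_transport)
open Summit.QuantumFields.BalabanUV.Beta.GAN24.CombTransportThreeLegs (isFF_transport)
open Summit.QuantumFields.BalabanUV.Beta.GAN24.CombTransportPush (legDecay_psiKS push₃_transport_eq_push₃_legComp)

namespace Summit.QuantumFields.BalabanUV.Beta.GAN24.CombWilsonStepPush

variable {d : ℕ}

/-! ## §1 Units commute with the fixed transport -/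

section Units

variable (r : Fin (d + 1) → ℕ) (n : ℕ)

/-- [folklore] The fibre-type weights pass through `Ψ̂` on the right: `Ψ̂ x y a b · ℓ b = ℓ a · Ψ̂ x y a b` (same type: equal weights; mixed: `Ψ̂ = 0`). -/
theorem psiKS_mul_legScale (s t : ℝ) (x y : Site (d + 1)) (a b : Fib d) :
    psiKS r n x y a b * legScale s t b = legScale s t a * psiKS r n x y a b := by
  rcases a with α | μ <;> rcases b with β | ν
  · rw [legScale_inl, legScale_inl, mul_comm]
  · rw [psiKS_inl_inr, zero_mul, mul_zero]
  · rw [psiKS_inr_inl, zero_mul, mul_zero]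
  · rw [legScale_inr, legScale_inr, mul_comm]

/-- [folklore] … and through `Ψ̂ᵀ`. -/
theorem trK_psiKS_mul_legScale (s t : ℝ) (x y : Site (d + 1)) (a b : Fib d) :
    trK (psiKS r n) x y a b * legScale s t b = legScale s t a * trK (psiKS r n) x y a b := by
  rw [trK_apply]
  rcases a with α | μ <;> rcases b with β | ν
  · rw [legScale_inl, legScale_inl, mul_comm]
  · rw [psiKS_inr_inl, zero_mul, mul_zero]
  · rw [psiKS_inl_inr, zero_mul, mul_zero]
  · rw [legScale_inr, legScale_inr, mul_comm]

/-- [folklore] **THE CONTRAGREDIENT CHANGE OF UNITS COMMUTES WITH THE `Ψ̂`-CONGRUENCE**: `D⁻¹ (Ψ̂ᵀ∘V∘Ψ̂) D⁻¹ = Ψ̂ᵀ∘(D⁻¹ V D⁻¹)∘Ψ̂` (any `sf sm`, any `V`;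
FP's `comp_scaleK_of_comm ∕ scaleK_comp_of_comm` BY NAME). -/
theorem counitK_conj_psiKS (sf sm : ℝ) (V : MKer (d + 1) (Fib d)) :
    counitK sf sm (comp (comp (trK (psiKS r n)) V) (psiKS r n)) = comp (comp (trK (psiKS r n)) (counitK sf sm V)) (psiKS r n) := by
  show scaleK (legScale sf⁻¹ sm⁻¹) (legScale sf⁻¹ sm⁻¹) (comp (comp (trK (psiKS r n)) V) (psiKS r n))
    = comp (comp (trK (psiKS r n)) (scaleK (legScale sf⁻¹ sm⁻¹) (legScale sf⁻¹ sm⁻¹) V)) (psiKS r n)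
  rw [comp_scaleK_of_comm (fun x y a b => trK_psiKS_mul_legScale r n sf⁻¹ sm⁻¹ x y a b),
    scaleK_comp_of_comm (fun y z f c => (psiKS_mul_legScale r n sf⁻¹ sm⁻¹ y z f c).symm)]

/-- [folklore] **THE SLOT TRANSPORT COMMUTES WITH ANY `ℝ`-LINEAR MAP OF THE VALUES**: `slotPsiS r n (L ∘ T) α x = L (slotPsiS r n T α x)`.
(PRIVATE on purpose: the public home of this generic bridge is leaf-03 g79's `PsiTableDefectOfDivergences.slotPsiS_map` (INTENT-4 l.65406) ∕ a later
`SymCorrectorFace` append — one home; road-P2 W-5 l.65494.) -/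
private theorem slotPsiS_map {E E' : Type*} [AddCommGroup E] [Module ℝ E] [AddCommGroup E'] [Module ℝ E'] (L : E →ₗ[ℝ] E')
    (T : Fin (d + 1) → Site (d + 1) → E) (α : Fin (d + 1)) (x : Site (d + 1)) :
    slotPsiS r n (fun κ u => L (T κ u)) α x = L (slotPsiS r n T α x) := by
  simp only [SymCorrectorFace.slotPsiS_apply, map_add, map_smul, map_sum]

/-- [folklore] **THE SLOT TRANSPORT COMMUTES WITH THE CHANGE OF UNITS OF A TABLE**: `slotPsiS r n (unitS sf sm X) = unitS sf sm (slotPsiS r n X)`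
(the unit weights `(sf·sm)⁻¹·ℓ(a)·ℓ(b)` depend on the fibre types only, not on the slot). -/
theorem slotPsiS_unitS (sf sm : ℝ) (X : Fin (d + 1) → Site (d + 1) → MKer (d + 1) (Fib d)) :
    slotPsiS r n (unitS sf sm X) = unitS sf sm (slotPsiS r n X) := by
  funext κ u x z a b
  rw [slotPsiS_apply_kernel, unitS_apply, slotPsiS_apply_kernel]
  have e : (fun κ' u' => unitS sf sm X κ' u' x z a b)
      = fun κ' u' => (LinearMap.mulLeft ℝ ((sf * sm)⁻¹ * legScale sf⁻¹ sm⁻¹ a * legScale sf⁻¹ sm⁻¹ b)) (X κ' u' x z a b) := by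
    funext κ' u'
    rw [unitS_apply, LinearMap.mulLeft_apply]
    ring
  rw [e, slotPsiS_map, LinearMap.mulLeft_apply]
  ring

/-- [folklore] **UNITS COMMUTE WITH THE FIXED TRANSPORT `𝒯`**: `unitS sf sm (𝒯 X) = 𝒯 (unitS sf sm X)` (any `sf sm`, any table `X`). -/
theorem unitS_transport (sf sm : ℝ) (X : Fin (d + 1) → Site (d + 1) → MKer (d + 1) (Fib d)) :
    unitS sf sm (fun κ u => comp (comp (trK (psiKS r n)) (slotPsiS r n X κ u)) (psiKS r n))
      = fun κ u => comp (comp (trK (psiKS r n)) (slotPsiS r n (unitS sf sm X) κ u)) (psiKS r n) := by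
  funext κ u
  show (sf * sm)⁻¹ • counitK sf sm (comp (comp (trK (psiKS r n)) (slotPsiS r n X κ u)) (psiKS r n)) = _
  rw [counitK_conj_psiKS, slotPsiS_unitS, ← KernelReflection.comp_smul_left, ← KernelReflection.comp_smul_right]
  rfl

end Units

/-! ## §2 One (III′) cubic step in the adopted units -/

section Step

variable {Lc : ℕ} [NeZero Lc]

/-- NOT IN PRINT; OUR BOOKKEEPING ([folklore]).  **ONE (III′) CUBIC STEP, IN UNITS** (any localised table `X`, any pin `cE`):
`unitS_{j+1} ((cE·wE (j+1)) • e3OfK Lc (GcombSh Lc j) X) = (cE·Lc^{2(d+1)}) • e3K (coDressKBmAt ρ_c Lc K̃_j) Lc (unitS_j (𝒯 X))`, `K̃_j = KStepUnit Lc j`. -/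
theorem unitS_combCubicStep_eq (cE : ℝ) (j : ℕ) {X : Fin (d + 1) → Site (d + 1) → MKer (d + 1) (Fib d)} {C δ : ℝ}
    (hX : LocStencil X C δ) (hδ : 0 < δ) :
    unitS (sfStep Lc (j + 1)) (smStep d Lc (j + 1)) (fun κ' u' => (cE * wE d Lc (j + 1)) • e3OfK Lc (GcombSh (d := d) Lc j) X κ' u')
      = fun κ' u' => (cE * (Lc : ℝ) ^ (2 * (d + 1))) •
          e3K (coDressKBmAt (ctr (d + 1) Lc) Lc (KStepUnit (d := d) Lc j)) Lc
            (unitS (sfStep Lc j) (smStep d Lc j)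
              (fun κ u => comp (comp (trK (psiKS (ctrOff (d + 1) Lc) Lc)) (slotPsiS (ctrOff (d + 1) Lc) Lc X κ u)) (psiKS (ctrOff (d + 1) Lc) Lc)))
            κ' u' := by
  have hsfj : sfStep Lc j ≠ 0 := sfStep_ne_zero j
  have hsmj : smStep d Lc j ≠ 0 := smStep_ne_zero (d := d) j
  have e : (fun κ' u' => (cE * wE d Lc (j + 1)) • e3OfK Lc (GcombSh (d := d) Lc j) X κ' u')
      = fun κ' u' => (cE * wE d Lc (j + 1)) • e3K (coDressKBmAt (ctr (d + 1) Lc) Lc (KInvStep (d := d) Lc j)) Lc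
          (fun κ u => comp (comp (trK (psiKS (ctrOff (d + 1) Lc) Lc)) (slotPsiS (ctrOff (d + 1) Lc) Lc X κ u)) (psiKS (ctrOff (d + 1) Lc) Lc)) κ' u' := by
    funext κ' u'
    rw [e3OfK_GcombSh_eq_bm_transport j hX hδ, e3OfK_eq_e3K]
  rw [e, unitS_cubicPiece_eq cE j, unitK_coDressKBmAt (ctr (d + 1) Lc) Lc hsfj hsmj (KInvStep (d := d) Lc j), ← KStepUnit_eq]

/-- NOT IN PRINT; OUR BOOKKEEPING ([folklore]).  **… FOR AN ff-VALUED TABLE IT IS ONE PUSH THROUGH `R_j` OF THE TRANSPORTED TABLE**: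
`= (cE·Lc^{2(d+1)}) • push₃ R_j R_j R_j (unitS_j (𝒯 X))` (`𝒯 X` is ff-valued: M.46 `isFF_transport`; leaf-03's `e3K_coDressKBmAt_KStepUnit_of_isFF`). -/
theorem unitS_combCubicStep_eq_push₃ (cE : ℝ) (j : ℕ) {X : Fin (d + 1) → Site (d + 1) → MKer (d + 1) (Fib d)} (hff : ∀ κ u, IsFF (X κ u))
    {C δ : ℝ} (hX : LocStencil X C δ) (hδ : 0 < δ) :
    unitS (sfStep Lc (j + 1)) (smStep d Lc (j + 1)) (fun κ' u' => (cE * wE d Lc (j + 1)) • e3OfK Lc (GcombSh (d := d) Lc j) X κ' u')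
      = fun κ' u' => (cE * (Lc : ℝ) ^ (2 * (d + 1))) •
          push₃ (respStepBmSeq (ctr (d + 1) Lc) Lc j) (respStepBmSeq (ctr (d + 1) Lc) Lc j) (respStepBmSeq (ctr (d + 1) Lc) Lc j)
            (unitS (sfStep Lc j) (smStep d Lc j)
              (fun κ u => comp (comp (trK (psiKS (ctrOff (d + 1) Lc) Lc)) (slotPsiS (ctrOff (d + 1) Lc) Lc X κ u)) (psiKS (ctrOff (d + 1) Lc) Lc)))
            κ' u' := by
  have hLc : 0 < Lc := Nat.pos_of_ne_zero (NeZero.ne Lc)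
  have hr : ctrOff (d + 1) Lc ∈ box (d + 1) Lc := ctrOff_mem_box hLc
  rw [unitS_combCubicStep_eq cE j hX hδ]
  funext κ' u'
  show (cE * (Lc : ℝ) ^ (2 * (d + 1))) • e3K (coDressKBmAt (ctr (d + 1) Lc) Lc (KStepUnit (d := d) Lc j)) Lc _ κ' u' = _
  rw [e3K_coDressKBmAt_KStepUnit_of_isFF (ctr (d + 1) Lc) j
    (isFF_unitS (fun κ u => isFF_transport hLc hr hff κ u) (sfStep Lc j) (smStep d Lc j)) κ' u']

/-- NOT IN PRINT; OUR BOOKKEEPING ([folklore]).  **… = ONE PUSH THROUGH THE CONJUGATED LEGS `ψ♭ ∘ R_j` OF THE TABLE ITSELF**: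
`= (cE·Lc^{2(d+1)}) • push₃ (legComp ψ♭ R_j) (legComp ψ♭ R_j) (legComp ψ♭ R_j) (unitS_j X)` (§1 `unitS_transport` + M.47 `push₃_transport_eq_push₃_legComp`;
the units of `X` are localised by `locStencil_unitS` and ff-valued by leaf-03's `isFF_unitS`).  At (E) the same display with `R_j` in place of `ψ♭ ∘ R_j` is
leaf-03's `unitS_wilsonSecAt_succ_eq_push₃_step`. -/
theorem unitS_combCubicStep_eq_push₃_legComp (cE : ℝ) (j : ℕ) {X : Fin (d + 1) → Site (d + 1) → MKer (d + 1) (Fib d)} (hff : ∀ κ u, IsFF (X κ u))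
    {C δ : ℝ} (hX : LocStencil X C δ) (hδ : 0 < δ) :
    unitS (sfStep Lc (j + 1)) (smStep d Lc (j + 1)) (fun κ' u' => (cE * wE d Lc (j + 1)) • e3OfK Lc (GcombSh (d := d) Lc j) X κ' u')
      = fun κ' u' => (cE * (Lc : ℝ) ^ (2 * (d + 1))) •
          push₃ (legComp (fun α x κ u => psiKS (ctrOff (d + 1) Lc) Lc u x (Sum.inl κ) (Sum.inl α)) (respStepBmSeq (ctr (d + 1) Lc) Lc j))
            (legComp (fun α x κ u => psiKS (ctrOff (d + 1) Lc) Lc u x (Sum.inl κ) (Sum.inl α)) (respStepBmSeq (ctr (d + 1) Lc) Lc j))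
            (legComp (fun α x κ u => psiKS (ctrOff (d + 1) Lc) Lc u x (Sum.inl κ) (Sum.inl α)) (respStepBmSeq (ctr (d + 1) Lc) Lc j))
            (unitS (sfStep Lc j) (smStep d Lc j) X) κ' u' := by
  have hLc : 0 < Lc := Nat.pos_of_ne_zero (NeZero.ne Lc)
  have hr : ctrOff (d + 1) Lc ∈ box (d + 1) Lc := ctrOff_mem_box hLc
  obtain ⟨CR, mR, hmR, hR'⟩ := legDecay_respStepBmSeq (Lc := Lc) hr j
  have hR : LegDecay (respStepBmSeq (ctr (d + 1) Lc) Lc j) Lc CR mR := hR'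
  rw [unitS_combCubicStep_eq_push₃ cE j hff hX hδ, unitS_transport]
  funext κ' u'
  show (cE * (Lc : ℝ) ^ (2 * (d + 1))) • push₃ _ _ _ _ κ' u' = _
  rw [push₃_transport_eq_push₃_legComp hLc hr hR hR hR hmR
    (fun κ u => isFF_unitS hff (sfStep Lc j) (smStep d Lc j) κ u) (locStencil_unitS hX) hδ κ' u']

end Step

/-! ## §3 Any family obeying the (III′) Wilson recursion, in units, is one push of `wilsonA` through the conjugated leg chains -/

section Lineage

variable {Lc : ℕ} [NeZero Lc]

/-- [folklore] **THE CONJUGATED DRESSED LEGS ARE LOCALISED**: `∃ C m, 0 < m ∧ LegDecay (legComp ψ♭ R) Lc C m` whenever `R` is (`ψ♭` decays at EVERY rate on scale `1`: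
M.47 `legDecay_psiKS`; leaf-01's `Push4NestAux.legDecay_legComp` at half the rate). -/
theorem legDecay_legComp_psiKS {n : ℕ} (hn : 0 < n) {r : Fin (d + 1) → ℕ} (hr : r ∈ box (d + 1) n) {N : ℕ} {R : LegFam d}
    (hR : ∃ C m : ℝ, 0 < m ∧ LegDecay R N C m) :
    ∃ C m : ℝ, 0 < m ∧ LegDecay (legComp (fun α x κ u => psiKS r n u x (Sum.inl κ) (Sum.inl α)) R) N C m := by
  obtain ⟨C₁, m₁, hm₁, h₁⟩ := hR
  obtain ⟨C₂, h₂⟩ := legDecay_psiKS (d := d) hn hr hm₁.le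
  have h := legDecay_legComp h₁ h₂ (m' := m₁ / 2) (by positivity) (by linarith) (by rw [Nat.cast_one, mul_one]; linarith)
  rw [one_mul] at h
  exact ⟨_, m₁ / 2, by positivity, h⟩

variable (Lc) in
/-- [folklore] **EVERY MEMBER OF A (III′) WILSON FAMILY IS ff-VALUED** (member `0`: `wilsonA`; member `j+1`: `e3OfK … = −mmRead …`). -/
theorem isFF_of_combWilsonRec (cE : ℝ) {W : ℕ → Fin (d + 1) → Site (d + 1) → MKer (d + 1) (Fib d)}
    (h0 : W 0 = fun κ u => cE • wilsonA d κ u)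
    (hsucc : ∀ j, W (j + 1) = fun κ' u' => (cE * wE d Lc (j + 1)) • e3OfK Lc (GcombSh (d := d) Lc j) (W j) κ' u') :
    ∀ (j : ℕ) (κ : Fin (d + 1)) (u : Site (d + 1)), IsFF (W j κ u)
  | 0, κ, u => by rw [h0]; exact isFF_smul (isFF_wilsonA κ u) cE
  | j + 1, κ, u => by
    rw [hsucc j]
    refine isFF_smul ⟨fun x z μ b => ?_, fun x z a ν => ?_⟩ _
    · rw [e3OfK_apply, (isFF_mmRead _ _).1, neg_zero]
    · rw [e3OfK_apply, (isFF_mmRead _ _).2, neg_zero]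

variable (Lc) in
/-- [folklore] **EVERY MEMBER OF A (III′) WILSON FAMILY IS A LOCALISED STENCIL FAMILY** (lit `locStencil_wilsonA`; an2's `locStencil_e3OfK` with `decays_GcombSh`). -/
theorem locStencil_of_combWilsonRec (cE : ℝ) {W : ℕ → Fin (d + 1) → Site (d + 1) → MKer (d + 1) (Fib d)}
    (h0 : W 0 = fun κ u => cE • wilsonA d κ u)
    (hsucc : ∀ j, W (j + 1) = fun κ' u' => (cE * wE d Lc (j + 1)) • e3OfK Lc (GcombSh (d := d) Lc j) (W j) κ' u') :
    ∀ j : ℕ, ∃ C δ : ℝ, 0 < δ ∧ LocStencil (W j) C δ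
  | 0 => ⟨_, 1, one_pos, by rw [h0]; exact locStencil_smul cE (locStencil_wilsonA (d := d) zero_le_one)⟩
  | j + 1 => by
    obtain ⟨C, δ, hδ, hW⟩ := locStencil_of_combWilsonRec cE h0 hsucc j
    obtain ⟨C', δ', hδ', h'⟩ := locStencil_e3OfK (N := Lc) (one_le_of_neZero Lc) (decays_GcombSh Lc j) hW hδ
    exact ⟨_, δ', hδ', by rw [hsucc j]; exact locStencil_smul _ h'⟩

variable (Lc) in
/-- NOT IN PRINT; OUR BOOKKEEPING ([folklore]).  **A (III′) WILSON FAMILY IN UNITS IS THE k-FOLD TRANSPORT OF `wilsonA` BY THE PUSHES THROUGH THE CONJUGATED LEGS**: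
`unitS_{k+1} (W (k+1)) = (cE·c₃^{k+1}) • transport (fun j T ↦ push₃ (ψ♭∘R_j) (ψ♭∘R_j) (ψ♭∘R_j) T) 0 (k+1) (wilsonA d)` (§2 `unitS_combCubicStep_eq_push₃_legComp` levelwise;
`push₃_smul` pulls the j-free weights out).  Leaf-03's `unitS_wilsonSecAt_succ_eq_transport` is the (E) twin (legs `R_j`). -/
theorem unitS_combWilson_succ_eq_transport (cE : ℝ) {W : ℕ → Fin (d + 1) → Site (d + 1) → MKer (d + 1) (Fib d)}
    (h0 : W 0 = fun κ u => cE • wilsonA d κ u)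
    (hsucc : ∀ j, W (j + 1) = fun κ' u' => (cE * wE d Lc (j + 1)) • e3OfK Lc (GcombSh (d := d) Lc j) (W j) κ' u') :
    ∀ k : ℕ, unitS (sfStep Lc (k + 1)) (smStep d Lc (k + 1)) (W (k + 1))
      = fun κ' u' => (cE * (cE * (Lc : ℝ) ^ (2 * (d + 1))) ^ (k + 1)) •
          transport (fun j T => push₃
              (legComp (fun α x κ u => psiKS (ctrOff (d + 1) Lc) Lc u x (Sum.inl κ) (Sum.inl α)) (respStepBmSeq (ctr (d + 1) Lc) Lc j))
              (legComp (fun α x κ u => psiKS (ctrOff (d + 1) Lc) Lc u x (Sum.inl κ) (Sum.inl α)) (respStepBmSeq (ctr (d + 1) Lc) Lc j))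
              (legComp (fun α x κ u => psiKS (ctrOff (d + 1) Lc) Lc u x (Sum.inl κ) (Sum.inl α)) (respStepBmSeq (ctr (d + 1) Lc) Lc j)) T)
            0 (k + 1) (wilsonA d) κ' u'
  | 0 => by
    obtain ⟨C, δ, hδ, hW⟩ := locStencil_of_combWilsonRec Lc cE h0 hsucc 0
    rw [hsucc 0, unitS_combCubicStep_eq_push₃_legComp cE 0 (isFF_of_combWilsonRec Lc cE h0 hsucc 0) hW hδ, unitS_step_zero, h0]
    funext κ' u'
    show (cE * (Lc : ℝ) ^ (2 * (d + 1))) • push₃ _ _ _ (fun κ u => cE • wilsonA d κ u) κ' u' = _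
    rw [push₃_smul, smul_smul]
    simp only [transport_succ, transport_zero, Nat.zero_add]
    congr 1
    ring
  | k + 1 => by
    obtain ⟨C, δ, hδ, hW⟩ := locStencil_of_combWilsonRec Lc cE h0 hsucc (k + 1)
    rw [hsucc (k + 1), unitS_combCubicStep_eq_push₃_legComp cE (k + 1) (isFF_of_combWilsonRec Lc cE h0 hsucc (k + 1)) hW hδ,
      unitS_combWilson_succ_eq_transport cE h0 hsucc k]
    funext κ' u'
    show (cE * (Lc : ℝ) ^ (2 * (d + 1))) • push₃ _ _ _
        (fun κ u => (cE * (cE * (Lc : ℝ) ^ (2 * (d + 1))) ^ (k + 1)) • transport _ 0 (k + 1) (wilsonA d) κ u) κ' u' = _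
    rw [push₃_smul, smul_smul]
    simp only [transport_succ, Nat.zero_add]
    congr 1
    ring

variable (Lc) in
/-- NOT IN PRINT; OUR BOOKKEEPING ([folklore]; the (III′) twin of leaf-03's (E-α-W) `SrecWilsonSector.unitS_wilsonSecAt_succ_eq_push₃`).
**A (III′) WILSON FAMILY, MEMBER `k+1`, IN THE ADOPTED UNITS, IS ONE THREE-LEG PUSH OF `wilsonA` THROUGH THE CONJUGATED DRESSED LEG CHAIN IN ALL THREE SLOTS**:
`unitS_{k+1} (W (k+1)) = fun κ′ u′ ↦ (cE·(cE·Lc^{2(d+1)})^{k+1}) • push₃ T′ T′ T′ (wilsonA d) κ′ u′`, `T′ = legChain (fun j ↦ legComp ψ♭ R_j) 0 k`, `R_j = respStepBmSeq ρ_c Lc j`,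
`ψ♭ α x κ u = Ψ̂_S u x (inl κ) (inl α)` at the comb chart's `(ctrOff, Lc)` — the (E) statement token for token with `R_j ↦ legComp ψ♭ R_j`.  What a (III′) CUBIC-WILSON CELL
ROW needs beyond the (E) one is therefore EXACTLY the effect of ONE `ψ♭` per leg per level (M.46: identity + face terms fed by the leg-divergence letters). -/
theorem unitS_combWilson_succ_eq_push₃ (cE : ℝ) {W : ℕ → Fin (d + 1) → Site (d + 1) → MKer (d + 1) (Fib d)}
    (h0 : W 0 = fun κ u => cE • wilsonA d κ u)
    (hsucc : ∀ j, W (j + 1) = fun κ' u' => (cE * wE d Lc (j + 1)) • e3OfK Lc (GcombSh (d := d) Lc j) (W j) κ' u') (k : ℕ) :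
    unitS (sfStep Lc (k + 1)) (smStep d Lc (k + 1)) (W (k + 1))
      = fun κ' u' => (cE * (cE * (Lc : ℝ) ^ (2 * (d + 1))) ^ (k + 1)) •
          push₃
            (legChain (fun j => legComp (fun α x κ u => psiKS (ctrOff (d + 1) Lc) Lc u x (Sum.inl κ) (Sum.inl α)) (respStepBmSeq (ctr (d + 1) Lc) Lc j)) 0 k)
            (legChain (fun j => legComp (fun α x κ u => psiKS (ctrOff (d + 1) Lc) Lc u x (Sum.inl κ) (Sum.inl α)) (respStepBmSeq (ctr (d + 1) Lc) Lc j)) 0 k)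
            (legChain (fun j => legComp (fun α x κ u => psiKS (ctrOff (d + 1) Lc) Lc u x (Sum.inl κ) (Sum.inl α)) (respStepBmSeq (ctr (d + 1) Lc) Lc j)) 0 k)
            (wilsonA d) κ' u' := by
  have hLc : 0 < Lc := Nat.pos_of_ne_zero (NeZero.ne Lc)
  have hr : ctrOff (d + 1) Lc ∈ box (d + 1) Lc := ctrOff_mem_box hLc
  have hS : ∃ C δ : ℝ, 0 < δ ∧ LocStencil (wilsonA d) C δ := ⟨_, 1, one_pos, locStencil_wilsonA (d := d) zero_le_one⟩
  have hT : ∀ j, ∃ C m : ℝ, 0 < m ∧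
      LegDecay (legComp (fun α x κ u => psiKS (ctrOff (d + 1) Lc) Lc u x (Sum.inl κ) (Sum.inl α)) (respStepBmSeq (ctr (d + 1) Lc) Lc j)) Lc C m :=
    fun j => legDecay_legComp_psiKS hLc hr (R := respStepBmSeq (ctr (d + 1) Lc) Lc j) (legDecay_respStepBmSeq (Lc := Lc) hr j)
  rw [unitS_combWilson_succ_eq_transport Lc cE h0 hsucc k, transport_push₃ (one_le_of_neZero Lc) hT hT hT hS 0 k]

end Lineage

end Summit.QuantumFields.BalabanUV.Beta.GAN24.CombWilsonStepPush
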